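import Summits.KontsevichZagierPeriods.KontsevichZagierPeriods.Theorems.UnfoldedStokesStokesGenerationStubRungTransportCertificate
import Literature.NumberTheory.Transcendental.SemialgebraicMapsProofs
import Literature.NumberTheory.Transcendental.KZCubicalCalculus

/-!
# `StokesGeneration` (stmt-KontsevichZagierPeriods-3586), line `fibrewise_stokes` — rung 2′: the rule-(2) relators of the interval

Crux `Summit.KontsevichZagierPeriods.KontsevichZagierPeriods.Theses.UnfoldedStokes.StokesGeneration` (kernel-checked
equivalent to the summit). Line `fibrewise_stokes` reduces it to the residual S2 = `FibrewiseStokesGenerationConjecture`: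
every bounded closed-cube representation of value `0` is, after padding and off a null `ℚ`-semialgebraic set, a finite
sum of FIBREWISE STOKES ELEMENTS `D − (G|_{xᵢ=1} − G|_{xᵢ=0})` — in particular WITHOUT the change-of-variables move.

This file banks the first Baker-free evidence for the converse calibration (summit ⇒ S2): the CHANGE-OF-VARIABLES
RELATORS of Kontsevich–Zagier's rule (2) on the interval lie in S2's economy. For `f` of class `C¹` on `[0,1]` and an
orientation-preserving `C¹` reparametrisation `φ` of `[0,1]` (`φ 0 = 0`, `φ 1 = 1`, `φ (0,1) ⊆ (0,1)`), all
`ℚ`-semialgebraic (algebraic integrands allowed, not only rational ones), the relator `f − (f∘φ)·φ′` is the sum of TWO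
fibrewise Stokes elements on `[0,1]²`: the straight-line isotopy `φᵤ = (1 − u)·id + u·φ` and the one-dimensional
continuity equation `∂ᵤ[(f∘φᵤ)∂_zφᵤ] = ∂_z[(f∘φᵤ)∂ᵤφᵤ]` give primitives `G₀ = −(f∘φᵤ)(φ − id)` (direction `0`,
vanishing on `z = 0, 1` because `φ` fixes the endpoints) and `G₁ = (f∘φᵤ)·∂_zφᵤ` (direction `1`, boundary datum
`(f∘φ)φ′ − f`), with `D₀ + D₁ = 0` (`stub_rungTransportCertificate`, p127806). Rule (3) is one element by definition
and rule (1b) is linear, so on interval integrands only rule (1a) and the non-isotopic instances of rule (2) separate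
S2 from the four-move calculus.

References: M. Kontsevich, D. Zagier, *Periods* (2001), §1.2 rule (2); J. Ayoub, Ann. of Math. 181 (2015), Rem. 1.5;
J. Bochnak, M. Coste, M.-F. Roy, *Real Algebraic Geometry* (1998), §2.2.
-/

noncomputable section

set_option linter.dupNamespace false

namespace Summit.KontsevichZagierPeriods.KontsevichZagierPeriods.Cruxes.StokesGeneration.FibrewiseStokes

open MeasureTheory Set
open Literature.NumberTheory.Transcendental
open Literature.NumberTheory.Transcendental.KZ
open Literature.ModelTheory.ExponentialFields (IsSemialgebraic)

/-- Lifting a `ℚ`-semialgebraic function of the interval coordinate to the square (cylinder over the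
interval, then restriction to the square). [cite: BochnakCosteRoy1998, §2.2] -/
theorem isSemialgebraicFunOn_sq_of_interval {g : ℝ → ℝ}
    (hg : IsSemialgebraicFunOn ℚ (Set.pi Set.univ (fun _ : Fin 1 => Set.Icc (0:ℝ) 1)) (fun z => g (z 0))) :
    IsSemialgebraicFunOn ℚ (Set.pi Set.univ (fun _ : Fin 2 => Set.Icc (0:ℝ) 1)) (fun x => g (x 0)) := by
  have hS : IsSemialgebraic ℚ (Set.pi Set.univ (fun _ : Fin 2 => Set.Icc (0:ℝ) 1)) := by
    rw [← cube_eq_pi]; exact isSemialgebraic_cube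
  refine (hg.comp_init.mono (fun v hv => ?_) hS).congr fun v _ => ?_
  · show Fin.init v ∈ Set.pi Set.univ (fun _ : Fin 1 => Set.Icc (0:ℝ) 1)
    exact fun i _ => hv (Fin.castSucc i) (Set.mem_univ _)
  · simp [Fin.init]

/-- **S2 for the change-of-variables relators of rule (2) in dimension one (rung 2′, assembled; lead c4).**
For `f` of class `C¹` on `[0,1]` and an orientation-preserving `C¹` reparametrisation `φ` of `[0,1]`
(`φ 0 = 0`, `φ 1 = 1`, `φ (0,1) ⊆ (0,1)`), all `ℚ`-semialgebraic, a closed-interval representation with integrand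
the rule-(2) relator `f − (f∘φ)·φ′` (value `0` automatically) satisfies the conclusion of `FibrewiseStokesGeneration`
with `M′ = 2`, no kink set, no null set — TWO fibrewise Stokes elements, from the straight-line isotopy and the
one-dimensional continuity equation (`stub_rungTransportCertificate`). Baker-free; covers algebraic (non-rational)
integrands. [cite: KontsevichZagier2001, §1.2 rule (2)] -/
theorem fibrewiseStokesGeneration_transport :
    ∀ (f f' φ φ' : ℝ → ℝ),
      IsSemialgebraicFunOn ℚ (Set.pi Set.univ (fun _ : Fin 1 => Set.Icc (0:ℝ) 1)) (fun z => f (z 0)) →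
      IsSemialgebraicFunOn ℚ (Set.pi Set.univ (fun _ : Fin 1 => Set.Icc (0:ℝ) 1)) (fun z => f' (z 0)) →
      IsSemialgebraicFunOn ℚ (Set.pi Set.univ (fun _ : Fin 1 => Set.Icc (0:ℝ) 1)) (fun z => φ (z 0)) →
      IsSemialgebraicFunOn ℚ (Set.pi Set.univ (fun _ : Fin 1 => Set.Icc (0:ℝ) 1)) (fun z => φ' (z 0)) →
      ContinuousOn f (Set.Icc (0:ℝ) 1) → ContinuousOn f' (Set.Icc (0:ℝ) 1) →
      ContinuousOn φ (Set.Icc (0:ℝ) 1) → ContinuousOn φ' (Set.Icc (0:ℝ) 1) →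
      (∀ u ∈ Set.Ioo (0:ℝ) 1, HasDerivAt f (f' u) u) → (∀ u ∈ Set.Ioo (0:ℝ) 1, HasDerivAt φ (φ' u) u) →
      φ 0 = 0 → φ 1 = 1 → (∀ u ∈ Set.Icc (0:ℝ) 1, φ u ∈ Set.Icc (0:ℝ) 1) →
      (∀ u ∈ Set.Ioo (0:ℝ) 1, φ u ∈ Set.Ioo (0:ℝ) 1) →
      ∀ (t : IntegralRep 1), t.domain = Set.pi Set.univ (fun _ : Fin 1 => Set.Icc (0:ℝ) 1) →
      (∀ z ∈ Set.pi Set.univ (fun _ : Fin 1 => Set.Icc (0:ℝ) 1),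
        t.integrand z = f (z 0) - f (φ (z 0)) * φ' (z 0)) →
    ∃ (M' : ℕ) (hMM' : 1 ≤ M') (J : ℕ) (i : Fin J → Fin M') (G D : Fin J → (Fin M' → ℝ) → ℝ)
      (K : Fin J → Set (Fin M' → ℝ)) (q : Fin J → IntegralRep M') (Z : Set (Fin M' → ℝ)),
      (∀ j, IsSemialgebraicFunOn ℚ (Set.pi Set.univ (fun _ : Fin M' => Set.Icc (0:ℝ) 1)) (G j) ∧
        IsSemialgebraicFunOn ℚ (Set.pi Set.univ (fun _ : Fin M' => Set.Icc (0:ℝ) 1)) (D j) ∧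
        IsSemialgebraic ℚ (K j) ∧
        (∃ B : ℝ, ∀ x ∈ Set.pi Set.univ (fun _ : Fin M' => Set.Icc (0:ℝ) 1), |(G j) x| ≤ B) ∧
        (∀ x ∈ Set.pi Set.univ (fun _ : Fin M' => Set.Icc (0:ℝ) 1), Set.Finite {s : ℝ | Function.update x (i j) s ∈ (K j)}) ∧
        (∀ x ∈ Set.pi Set.univ (fun _ : Fin M' => Set.Icc (0:ℝ) 1), ContinuousOn (fun s : ℝ => (G j) (Function.update x (i j) s)) (Set.Icc (0:ℝ) 1)) ∧
        (∀ x ∈ Set.pi Set.univ (fun _ : Fin M' => Set.Icc (0:ℝ) 1), x ∉ (K j) → x (i j) ∈ Set.Ioo (0:ℝ) 1 →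
          HasDerivAt (fun s : ℝ => (G j) (Function.update x (i j) s)) ((D j) x) (x (i j)))) ∧
      (∀ j, (q j).domain = Set.pi Set.univ (fun _ : Fin M' => Set.Icc (0:ℝ) 1) ∧
        ∀ x ∈ Set.pi Set.univ (fun _ : Fin M' => Set.Icc (0:ℝ) 1), (q j).integrand x =
          D j x - (G j (Function.update x (i j) 1) - G j (Function.update x (i j) 0))) ∧
      IsSemialgebraic ℚ Z ∧ volume Z = 0 ∧
      ∀ x ∈ Set.pi Set.univ (fun _ : Fin M' => Set.Icc (0:ℝ) 1), x ∉ Z →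
        t.integrand (fun l => x (Fin.castLE hMM' l)) = ∑ j, (q j).integrand x := by
  intro f f' φ φ' hf hf' hφ hφ' hfc hf'c hφc hφ'c hfd hφd hφ0 hφ1 hφI hφo t _ hti
  obtain ⟨G, D, r, hGD, hr, hid⟩ := stub_rungTransportCertificate f f' φ φ'
    (isSemialgebraicFunOn_sq_of_interval hf) (isSemialgebraicFunOn_sq_of_interval hf')
    (isSemialgebraicFunOn_sq_of_interval hφ) (isSemialgebraicFunOn_sq_of_interval hφ')
    hfc hf'c hφc hφ'c hfd hφd hφ0 hφ1 hφI hφo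
  refine ⟨2, by norm_num, 2, fun j => j, G, D, fun _ => ∅, r, ∅, fun j => ?_, hr,
    Literature.ModelTheory.ExponentialFields.isSemialgebraic_empty, measure_empty, ?_⟩
  · obtain ⟨h1, h2, h3, h4, h5⟩ := hGD j
    exact ⟨h1, h2, Literature.ModelTheory.ExponentialFields.isSemialgebraic_empty, h3,
      fun x _ => by simp, h4, fun x hx _ hxj => h5 x hx hxj⟩
  · intro x hx _
    have hx1 : (fun l : Fin 1 => x (Fin.castLE (by norm_num : 1 ≤ 2) l)) ∈
        Set.pi Set.univ (fun _ : Fin 1 => Set.Icc (0:ℝ) 1) := fun l _ => hx _ (Set.mem_univ _)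
    rw [hti _ hx1]
    exact hid x hx

end Summit.KontsevichZagierPeriods.KontsevichZagierPeriods.Cruxes.StokesGeneration.FibrewiseStokes

end
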